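import Summits.CriticalPhenomena.PercolationContinuityZ3.Theorems.PercNearOneGluingNoHeavyLowerTailKnQuestion8CoefficientwiseCoreClassKernelMixFibreUpsetCore
import Summits.CriticalPhenomena.PercolationContinuityZ3.Theorems.PercNearOneGluingNoHeavyLowerTailKnQuestion8CoefficientwiseCoreClassKernelMixRegimeReduction
import HarnessLib

/-!
# The fibre up-set lemma, II: general levels (regime split + Harris + the `++` core)

Support file (`--supports stmt-CriticalPhenomena-4575`, closed), prover `prim-cplus-coupling` (gen 39).  No definitions, no notations, no named facts,
no sorries; standard axioms.  Memo `prim-cplus-coupling/A5-COUPLING-gen39.md` §2.3.  Companion of `…KernelMixFibreUpsetCore` (the `++` core) and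
`…KernelMixFibreInjection` (the other fibre lemma of THEOREM IET-CYCLE, memo §3).

* `Coefficientwise.fibreUpset_transfer` — **THE FIBRE UP-SET LEMMA** ('PF4′') in abstract form: for an up-closed demand family `F ∋ Q` on a cube `2^Q`
  carrying the structure of the observer's arc (suffix chain `T m`, b-side sets `J m`, run indices `jb, jr`) and cluster maps `X, Y, G` with
  `Y η ⊆ G(Q ∖ η)`, for all monotone levels:  `0 ≤ Σ_{η ∈ F∖{Q}} (hᵃXη − hᵇYη)(kᵃXη − kᵇYη) + Σ_{ζ ∈ F∖{∅}} h(Gζ)k(Gζ)`.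
  The partners are those of the up-set itself (`ζ ∪ W`, `ζ ∈ F`), the all-red point `G Q` included and the M-point excluded — exactly what the up-set
  `𝒱` of CONJECTURE IET provides when only one arc of the cycle carries demand (memo §3 (i),(ii)).  Proof: `regime_pointwise` at every demand point,
  ONE Harris inequality (`sum_mul_sdiff_le_sum_mul` on `2^Q` with the indicator of `F`) for each mixed regime, and `fibreUpset_core` for the `++` regime.
[cite: KozmaNitzan2024, Questions 8–9 (§5.5 p. 36) (context: the Question-8 pocket covariance programme)]
-/

namespace Summit.CriticalPhenomena.PercolationContinuityZ3.Theorems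

open Finset Literature.Probability.Percolation

namespace Coefficientwise

variable {ι V : Type*}

open Classical in
/-- **THE FIBRE UP-SET LEMMA** (abstract form of memo §2.3, 'PF4′').  Data: a nonempty cube `2^Q`, an up-closed family `F ∋ Q` of subsets of `Q`
(the demand up-set of the fibre, top = the phantom), set maps `X` (red cluster; monotone, `X ∅ = X₀ ⊆ X η ⊆ G η`), `Y` (blue cluster, covered by the
complement partner: `Y η ⊆ G(Q ∖ η)`), `G` (partner set; monotone, `G(Q ∖ T 1) = G Q`), a chain `∅ = T 0 ⊆ T 1 ⊆ ⋯ ⊆ Q` (`T 1 ≠ ∅`; suffixes of the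
arc) with b-side sets `J 0 ⊆ J 1 ⊆ ⋯` (`J (jr ζ) ⊆ G ζ`, `J L ⊆ G Q`), the blue-run index `jb` (`η ∩ T (jb η) = ∅`, `Y η ⊆ J (jb η)` whenever
`X η ≠ X₀`) and the red-run index `jr` (`T m ⊆ ζ ⇒ m ≤ jr ζ`).  Then for all monotone `h, k` and monotone levels `0 ≤ hᵃ, hᵇ ≤ h`, `0 ≤ kᵃ, kᵇ ≤ k`:
`0 ≤ Σ_{η ∈ F∖{Q}} (hᵃ(Xη) − hᵇ(Yη))(kᵃ(Xη) − kᵇ(Yη)) + Σ_{ζ ∈ F∖{∅}} h(Gζ)k(Gζ)`  — partners of the up-set only (all-red `= G Q` included, no M-point).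
Proof: regime split at `α₀ = hᵃX₀`, `γ₀ = kᵃX₀` (`regime_pointwise`); the two mixed regimes by ONE Harris inequality each on the up-set `F`
(`sum_mul_sdiff_le_sum_mul`); the `++` regime is `fibreUpset_core`.  For the cycle: `Q = A`, `T m` = last `m` edges, `J m = V(W) ∪ J_m`.
[cite: KozmaNitzan2024, Questions 8–9 (§5.5 p. 36) (context)] -/
theorem fibreUpset_transfer [DecidableEq ι] (Q : Finset ι) (hQne : Q.Nonempty) (F : Finset (Finset ι))
    (hFQ : ∀ η ∈ F, η ⊆ Q) (hFup : ∀ η ∈ F, ∀ ζ : Finset ι, η ⊆ ζ → ζ ⊆ Q → ζ ∈ F) (hQF : Q ∈ F)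
    (X Y G : Finset ι → Set V) (X₀ : Set V)
    (hXempty : X ∅ = X₀) (hX0 : ∀ η : Finset ι, η ⊆ Q → X₀ ⊆ X η)
    (hXmono : ∀ η ζ : Finset ι, η ⊆ ζ → ζ ⊆ Q → X η ⊆ X ζ) (hXG : ∀ ζ : Finset ι, ζ ⊆ Q → X ζ ⊆ G ζ)
    (hGmono : ∀ ζ ζ' : Finset ι, ζ ⊆ ζ' → ζ' ⊆ Q → G ζ ⊆ G ζ')
    (hYc : ∀ η : Finset ι, η ⊆ Q → Y η ⊆ G (Q \ η))
    (L : ℕ) (T : ℕ → Finset ι) (hT0 : T 0 = ∅) (hTmono : ∀ m m', m ≤ m' → T m ⊆ T m') (hTQ : ∀ m, T m ⊆ Q) (hT1 : (T 1).Nonempty)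
    (hGstar : G (Q \ T 1) = G Q)
    (J : ℕ → Set V) (hJmono : ∀ m m', m ≤ m' → J m ⊆ J m')
    (jr : Finset ι → ℕ) (hjrL : ∀ ζ ∈ F, jr ζ ≤ L) (hjr : ∀ ζ ∈ F, ∀ m, m ≤ L → T m ⊆ ζ → m ≤ jr ζ)
    (hJG : ∀ ζ ∈ F, J (jr ζ) ⊆ G ζ) (hJL : J L ⊆ G Q)
    (jb : Finset ι → ℕ) (hjbL : ∀ η ∈ F, η ≠ Q → X η ≠ X₀ → jb η ≤ L)
    (hjbT : ∀ η ∈ F, η ≠ Q → X η ≠ X₀ → Disjoint η (T (jb η)))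
    (hYJ : ∀ η ∈ F, η ≠ Q → X η ≠ X₀ → Y η ⊆ J (jb η))
    (h k ha hb ka kb : Set V → ℝ)
    (hh : Monotone h) (hk : Monotone k) (mha : Monotone ha) (mhb : Monotone hb) (mka : Monotone ka) (mkb : Monotone kb)
    (ha0 : ∀ S, 0 ≤ ha S) (hah : ∀ S, ha S ≤ h S) (hb0 : ∀ S, 0 ≤ hb S) (hbh : ∀ S, hb S ≤ h S)
    (ka0 : ∀ S, 0 ≤ ka S) (kak : ∀ S, ka S ≤ k S) (kb0 : ∀ S, 0 ≤ kb S) (kbk : ∀ S, kb S ≤ k S) :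
    0 ≤ (∑ η ∈ F.erase Q, (ha (X η) - hb (Y η)) * (ka (X η) - kb (Y η)))
      + ∑ ζ ∈ F.erase ∅, h (G ζ) * k (G ζ) := by
  set α₀ : ℝ := ha X₀ with hα₀
  set γ₀ : ℝ := ka X₀ with hγ₀
  have hα : 0 ≤ α₀ := ha0 X₀
  have hγ : 0 ≤ γ₀ := ka0 X₀
  -- reduced (regime `++`) data
  set a : Finset ι → ℝ := fun η => max (ha (X η) - α₀) 0 with haD
  set c : Finset ι → ℝ := fun η => max (ka (X η) - γ₀) 0 with hcD
  set q : Finset ι → ℝ := fun η => max (kb (Y η) - γ₀) 0 with hqD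
  set p : Finset ι → ℝ := fun η => max (hb (Y η) - α₀) 0 with hpD
  set Hs : Finset ι → ℝ := fun ζ => h (G ζ) - α₀ with hHsD
  set Ks : Finset ι → ℝ := fun ζ => k (G ζ) - γ₀ with hKsD
  set Qf : ℕ → ℝ := fun m => max (kb (J m) - γ₀) 0 with hQfD
  set Pf : ℕ → ℝ := fun m => max (hb (J m) - α₀) 0 with hPfD
  set Dom : Finset (Finset ι) := (F.erase Q).filter (fun η => X η ≠ X₀) with hDomD
  -- basic level facts on subsets of Q
  have hαX : ∀ η : Finset ι, η ⊆ Q → α₀ ≤ ha (X η) := fun η hη => mha (hX0 η hη)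
  have hγX : ∀ η : Finset ι, η ⊆ Q → γ₀ ≤ ka (X η) := fun η hη => mka (hX0 η hη)
  have hαG : ∀ ζ : Finset ι, ζ ⊆ Q → α₀ ≤ h (G ζ) := fun ζ hζ => le_trans (hαX ζ hζ) (le_trans (hah _) (hh (hXG ζ hζ)))
  have hγG : ∀ ζ : Finset ι, ζ ⊆ Q → γ₀ ≤ k (G ζ) := fun ζ hζ => le_trans (hγX ζ hζ) (le_trans (kak _) (hk (hXG ζ hζ)))
  have ha_eq : ∀ η : Finset ι, η ⊆ Q → a η = ha (X η) - α₀ := fun η hη => by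
    simp only [haD]; exact max_eq_left (sub_nonneg.mpr (hαX η hη))
  have hc_eq : ∀ η : Finset ι, η ⊆ Q → c η = ka (X η) - γ₀ := fun η hη => by
    simp only [hcD]; exact max_eq_left (sub_nonneg.mpr (hγX η hη))
  have hmemDom : ∀ η, η ∈ Dom ↔ (η ∈ F ∧ η ≠ Q) ∧ X η ≠ X₀ := by
    intro η; simp only [hDomD, Finset.mem_filter, Finset.mem_erase]; tauto
  -- the `++` core
  have core := fibreUpset_core Q hQne F hFQ hFup hQF Dom
    (fun η hη => ((hmemDom η).mp hη).1) 
    (fun η hη h0 => ((hmemDom η).mp hη).2 (by rw [h0, hXempty]))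
    L T hT0 hTmono hTQ hT1 jb
    (fun η hη => hjbL η ((hmemDom η).mp hη).1.1 ((hmemDom η).mp hη).1.2 ((hmemDom η).mp hη).2)
    (fun η hη => hjbT η ((hmemDom η).mp hη).1.1 ((hmemDom η).mp hη).1.2 ((hmemDom η).mp hη).2)
    jr hjrL hjr a c q p
    (fun η => le_max_right _ _) (fun η => le_max_right _ _) (fun η => le_max_right _ _) (fun η => le_max_right _ _)
    (fun η ζ hηζ hζQ => max_le_max (sub_le_sub_right (mha (hXmono η ζ hηζ hζQ)) _) (le_refl 0))
    (fun η ζ hηζ hζQ => max_le_max (sub_le_sub_right (mka (hXmono η ζ hηζ hζQ)) _) (le_refl 0))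
    (by
      intro η hηF hηQ hηDom
      have hx : X η = X₀ := by
        by_contra hx; exact hηDom ((hmemDom η).mpr ⟨⟨hηF, hηQ⟩, hx⟩)
      simp only [haD, hcD, hx, hα₀, hγ₀, sub_self, max_self, and_self])
    (by simp only [haD, hcD, hXempty, hα₀, hγ₀, sub_self, max_self, and_self])
    Qf Pf (le_max_right _ _) (le_max_right _ _)
    (fun m m' hmm' => max_le_max (sub_le_sub_right (mkb (hJmono m m' hmm')) _) (le_refl 0))
    (fun m m' hmm' => max_le_max (sub_le_sub_right (mhb (hJmono m m' hmm')) _) (le_refl 0))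
    (fun η hη => max_le_max (sub_le_sub_right (mkb (hYJ η ((hmemDom η).mp hη).1.1 ((hmemDom η).mp hη).1.2 ((hmemDom η).mp hη).2)) _) (le_refl 0))
    (fun η hη => max_le_max (sub_le_sub_right (mhb (hYJ η ((hmemDom η).mp hη).1.1 ((hmemDom η).mp hη).1.2 ((hmemDom η).mp hη).2)) _) (le_refl 0))
    Hs Ks
    (fun ζ hζ => max_le (sub_le_sub_right (le_trans (hah _) (hh (hXG ζ hζ))) _) (sub_nonneg.mpr (hαG ζ hζ)))
    (fun ζ hζ => max_le (sub_le_sub_right (le_trans (kak _) (hk (hXG ζ hζ))) _) (sub_nonneg.mpr (hγG ζ hζ)))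
    (fun ζ hζ => max_le (sub_le_sub_right (le_trans (kbk _) (hk (hJG ζ hζ))) _) (sub_nonneg.mpr (hγG ζ (hFQ ζ hζ))))
    (fun ζ hζ => max_le (sub_le_sub_right (le_trans (hbh _) (hh (hJG ζ hζ))) _) (sub_nonneg.mpr (hαG ζ (hFQ ζ hζ))))
    (max_le (sub_le_sub_right (le_trans (kbk _) (hk hJL)) _) (sub_nonneg.mpr (hγG Q (le_refl Q))))
    (max_le (sub_le_sub_right (le_trans (hbh _) (hh hJL)) _) (sub_nonneg.mpr (hαG Q (le_refl Q))))
    (by simp only [hHsD, hGstar]) (by simp only [hKsD, hGstar])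
  -- pointwise regime split of the anti-terms
  have hpt : ∀ η ∈ F.erase Q,
      (a η * c η - a η * q η - c η * p η) - α₀ * q η - γ₀ * p η ≤ (ha (X η) - hb (Y η)) * (ka (X η) - kb (Y η)) := by
    intro η hη
    have hηQ : η ⊆ Q := hFQ η (Finset.mem_of_mem_erase hη)
    have rp := regime_pointwise (α₀ := α₀) (γ₀ := γ₀) (a := ha (X η)) (p := hb (Y η)) (c := ka (X η)) (q := kb (Y η))
      hα hγ (hαX η hηQ) (hb0 _) (hγX η hηQ) (kb0 _)
    rw [ha_eq η hηQ, hc_eq η hηQ]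
    simp only [hqD, hpD]
    nlinarith [mul_nonneg (le_max_right (hb (Y η) - α₀) 0) (le_max_right (kb (Y η) - γ₀) 0)]
  -- supply split
  have hsup : ∀ ζ ∈ F.erase ∅, Hs ζ * Ks ζ + α₀ * Ks ζ + γ₀ * Hs ζ ≤ h (G ζ) * k (G ζ) := by
    intro ζ hζ
    simp only [hHsD, hKsD]
    nlinarith [mul_nonneg hα hγ]
  -- Harris on the up-set F: the excess (kᵇY − γ₀)⁺ over F∖Q is at most the budget over F∖∅
  have harris : ∀ (lv lvb : Set V → ℝ) (θ : ℝ), Monotone lv → Monotone lvb → (∀ S, lvb S ≤ lv S) → (∀ ζ : Finset ι, ζ ⊆ Q → θ ≤ lv (G ζ)) →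
      ∑ η ∈ F.erase Q, max (lvb (Y η) - θ) 0 ≤ ∑ ζ ∈ F.erase ∅, (lv (G ζ) - θ) := by
    intro lv lvb θ mlv mlvb hle hθ
    set Ff : Finset ι → ℝ := fun ω => if ω ∩ Q ∈ F then 1 else 0 with hFf
    set Gf : Finset ι → ℝ := fun ω => max (lvb (G (ω ∩ Q)) - θ) 0 with hGf
    have mFf : Monotone Ff := by
      intro s t hst
      simp only [hFf]
      by_cases hs : s ∩ Q ∈ F
      · rw [if_pos hs, if_pos (hFup _ hs (t ∩ Q) (Finset.inter_subset_inter hst (le_refl Q)) Finset.inter_subset_right)]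
      · rw [if_neg hs]; split_ifs <;> norm_num
    have mGf : Monotone Gf := by
      intro s t hst
      simp only [hGf]
      exact max_le_max (sub_le_sub_right (mlvb (hGmono _ _ (Finset.inter_subset_inter hst (le_refl Q)) Finset.inter_subset_right)) θ)
        (le_refl 0)
    have key := sum_mul_sdiff_le_sum_mul Q Ff Gf mFf mGf
    set c₀ : ℝ := max (lvb (G ∅) - θ) 0 with hc₀
    have hc₀0 : 0 ≤ c₀ := le_max_right _ _
    have eF : Q.powerset.filter (fun ω => ω ∈ F) = F := by
      ext ω; simp only [Finset.mem_filter, Finset.mem_powerset]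
      exact ⟨fun h' => h'.2, fun h' => ⟨hFQ ω h', h'⟩⟩
    -- left side of Harris dominates the demand excess (plus the top's term `c₀`)
    have lhs : c₀ + ∑ η ∈ F.erase Q, max (lvb (Y η) - θ) 0 ≤ ∑ ω ∈ Q.powerset, Ff ω * Gf (Q \ ω) := by
      have e1 : ∑ ω ∈ Q.powerset, Ff ω * Gf (Q \ ω) = ∑ ω ∈ Q.powerset, (if ω ∈ F then max (lvb (G (Q \ ω)) - θ) 0 else 0) := by
        refine Finset.sum_congr rfl fun ω hω => ?_
        have hωQ := Finset.mem_powerset.mp hω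
        simp only [hFf, hGf, Finset.inter_eq_left.mpr hωQ, Finset.inter_eq_left.mpr (Finset.sdiff_subset : Q \ ω ⊆ Q)]
        split_ifs <;> simp
      rw [e1, ← Finset.sum_filter, eF, ← Finset.add_sum_erase _ _ hQF, Finset.sdiff_self]
      have t1 : ∑ η ∈ F.erase Q, max (lvb (Y η) - θ) 0 ≤ ∑ η ∈ F.erase Q, max (lvb (G (Q \ η)) - θ) 0 :=
        Finset.sum_le_sum fun η hη => max_le_max (sub_le_sub_right (mlvb (hYc η (hFQ η (Finset.mem_of_mem_erase hη)))) θ) (le_refl 0)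
      have t2 : max (lvb (G (∅ : Finset ι)) - θ) 0 = c₀ := rfl
      linarith
    -- right side of Harris is dominated by the budget (plus `c₀`)
    have rhs : ∑ ω ∈ Q.powerset, Ff ω * Gf ω ≤ c₀ + ∑ ζ ∈ F.erase ∅, (lv (G ζ) - θ) := by
      have e1 : ∑ ω ∈ Q.powerset, Ff ω * Gf ω = ∑ ω ∈ Q.powerset, (if ω ∈ F then max (lvb (G ω) - θ) 0 else 0) := by
        refine Finset.sum_congr rfl fun ω hω => ?_
        have hωQ := Finset.mem_powerset.mp hω
        simp only [hFf, hGf, Finset.inter_eq_left.mpr hωQ]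
        split_ifs <;> simp
      rw [e1, ← Finset.sum_filter, eF]
      have bound : ∀ ζ ∈ F, max (lvb (G ζ) - θ) 0 ≤ lv (G ζ) - θ :=
        fun ζ hζ => max_le (sub_le_sub_right (hle _) θ) (sub_nonneg.mpr (hθ ζ (hFQ ζ hζ)))
      by_cases h0 : (∅ : Finset ι) ∈ F
      · rw [← Finset.add_sum_erase _ _ h0]
        have := Finset.sum_le_sum fun ζ (hζ : ζ ∈ F.erase ∅) => bound ζ (Finset.mem_of_mem_erase hζ)
        have e0 : max (lvb (G (∅ : Finset ι)) - θ) 0 = c₀ := rfl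
        linarith
      · rw [Finset.erase_eq_of_notMem h0]
        have := Finset.sum_le_sum bound
        linarith
    linarith
  have harrisK := harris k kb γ₀ hk mkb kbk hγG
  have harrisH := harris h hb α₀ hh mhb hbh hαG
  -- assemble
  have s1 := Finset.sum_le_sum hpt
  rw [Finset.sum_sub_distrib, Finset.sum_sub_distrib] at s1
  have s2 := Finset.sum_le_sum hsup
  rw [Finset.sum_add_distrib, Finset.sum_add_distrib] at s2
  have eq1 : ∑ η ∈ F.erase Q, α₀ * q η = α₀ * ∑ η ∈ F.erase Q, q η := by rw [Finset.mul_sum]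
  have eq2 : ∑ η ∈ F.erase Q, γ₀ * p η = γ₀ * ∑ η ∈ F.erase Q, p η := by rw [Finset.mul_sum]
  have eq3 : ∑ ζ ∈ F.erase ∅, α₀ * Ks ζ = α₀ * ∑ ζ ∈ F.erase ∅, Ks ζ := by rw [Finset.mul_sum]
  have eq4 : ∑ ζ ∈ F.erase ∅, γ₀ * Hs ζ = γ₀ * ∑ ζ ∈ F.erase ∅, Hs ζ := by rw [Finset.mul_sum]
  rw [eq1, eq2] at s1
  rw [eq3, eq4] at s2
  have hq' : ∑ η ∈ F.erase Q, q η ≤ ∑ ζ ∈ F.erase ∅, Ks ζ := by simp only [hqD, hKsD]; exact harrisK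
  have hp' : ∑ η ∈ F.erase Q, p η ≤ ∑ ζ ∈ F.erase ∅, Hs ζ := by simp only [hpD, hHsD]; exact harrisH
  have tK := mul_le_mul_of_nonneg_left hq' hα
  have tH := mul_le_mul_of_nonneg_left hp' hγ
  linarith [core, s1, s2, tK, tH]

end Coefficientwise

end Summit.CriticalPhenomena.PercolationContinuityZ3.Theorems
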